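import Summits.AtomisticToContinuum.HydrodynamicLimit.Theorems.MourreKoopmanChargesLinearToEntropyInBandStressRung
import HarnessLib

/-!
# `StressStrongMixing → EquilibriumStressVarianceDecay`: the second Mourre output lands on the SAME linear rung
# (crux `LinearToEntropyInBand`, stmt-AtomisticToContinuum-17740, route `MourreKoopmanCharges`)

Support file (`--supports stmt-AtomisticToContinuum-17740`, registered stub `stub_stressRungOfStrongMixing`) of the line
`registered`, skeleton v4 (lead prover-line-…-17740-c3-0).  Companion of
`Theorems/MourreKoopmanChargesLinearToEntropyInBandStressRung.lean` (`OneBodyCompleteness → EquilibriumStressVarianceDecay`).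

The crux takes BOTH typed outputs of the Mourre package as hypotheses: `OneBodyCompleteness` (stmt-9583, Cesàro /
Drude-weight form) and `StressStrongMixing` (stmt-9584: existence of the infinite-volume kinetic shear-stress
autocorrelation `c(s)` at every kinetic time, `(N+1)·E_{G_N}[Π(χ₁)∘Φ_{s(N+1)^{-1/3}} · Π(χ₂)] → c(s)∫χ₁χ₂`, and its
pointwise decay `c(s) → 0`).  This file proves that `StressStrongMixing` ALONE also implies rung C3 of route
OneFlightGossipEngine, `EquilibriumStressVarianceDecay` (stmt-9531) — so at the quadratic (`L²`, Green–Kubo) level of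
the kinetic shear-stress row the two hypotheses of the bridge are interchangeable, which bears on the planner's kill
criterion for the route ("the bridge needs only Drude weights": `StressStrongMixing` adds nothing at this level; what
it adds beyond — pointwise decay and the fixed-`s` infinite-volume limit — is not consumed by the Green–Kubo rung).

* `fejer_small_of_tendsto_zero` — the Fejér means `2τ⁻²∫₀^τ (τ − s) g(s) ds` of a bounded measurable `g` with
  `g(s) → 0` tend to `0`;
* `stub_stressRungOfStrongMixing` — for the kernel `K_N(s) = (N+1) C_N(s(N+1)^{-1/3})` (stress autocorrelation under
  the homogeneous Gibbs law, `|K_N| ≤ θ²K²E_γ‖w‖⁴` by `succ_mul_abs_corr_le`): pointwise in `s ≥ 0`,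
  `K_N(s) → c(s)∫φ²` (the hypothesis at `χ₁ = χ₂ = φ`, `integral_shearGerm_empiricalMeasure`); the limit is
  measurable as a pointwise limit (`measurable_of_tendsto_metrizable`, after extending by `0` to `s < 0`) and bounded;
  dominated convergence on `(0, τ]` (`intervalIntegral.tendsto_integral_filter_of_dominated_convergence`) gives
  `2τ⁻²∫₀^τ(τ−s)K_N(s)ds → 2τ⁻²∫₀^τ(τ−s)c(s)∫φ² ds`, small for large `τ`; then `fejerStress_of_kernel_small` and the
  landed equivalence `equilibriumStressVarianceDecay_iff_fejer_corr_decay` with the activity dummy.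

References: H. Spohn, *Large Scale Dynamics of Interacting Particles* (1991), Part I §7.1, Part II §1.7.
-/

noncomputable section

namespace Summit.AtomisticToContinuum.HydrodynamicLimit.Theorems.LTEInBand

open MeasureTheory ProbabilityTheory Filter Topology Set
open Literature.Analysis.FluidPDE Literature.MathematicalPhysics.KineticTheory
open scoped InnerProductSpace ENNReal Interval
open Summit.AtomisticToContinuum.HydrodynamicLimit.Theorems
open BoltzmannGreenKuboOrthMomentum BoltzmannGreenKuboForallN EquilibriumStressVarianceDecayC3
open Summit.AtomisticToContinuum.HydrodynamicLimit.Theses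

/-! ## § 1 Fejér means of a function tending to zero -/

/-- **Fejér means of a bounded measurable `g` with `g(s) → 0` tend to zero**:
`∀ ε > 0 ∃ T₀ > 0 ∀ τ ≥ T₀, 2τ⁻² ∫₀^τ (τ − s) g(s) ds ≤ ε` (split at `S` with `|g| ≤ ε/4` beyond `S`:
`|∫₀^τ (τ−s) g| ≤ τBS + τ²ε/4`). [folklore] -/
theorem fejer_small_of_tendsto_zero {g : ℝ → ℝ} (hgm : Measurable g) {B : ℝ}
    (hB : ∀ s, |g s| ≤ B) (hg : Tendsto g atTop (𝓝 0)) :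
    ∀ ε : ℝ, 0 < ε → ∃ T₀ : ℝ, 0 < T₀ ∧ ∀ τ : ℝ, T₀ ≤ τ →
      2 * τ⁻¹ ^ 2 * ∫ s in (0 : ℝ)..τ, (τ - s) * g s ≤ ε := by
  intro ε hε
  obtain ⟨S', hS'⟩ := Metric.tendsto_atTop.1 hg (ε / 4) (by positivity)
  set S : ℝ := max S' 0 with hS
  have hS0 : 0 ≤ S := le_max_right _ _
  have hgS : ∀ s, S ≤ s → |g s| ≤ ε / 4 := by
    intro s hs
    have h := hS' s ((le_max_left _ _).trans hs)
    rw [Real.dist_eq, sub_zero] at h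
    exact h.le
  set T₀ : ℝ := max (S + 1) (4 * B * S / ε) with hT₀
  refine ⟨T₀, lt_max_of_lt_left (by linarith), fun τ hτ => ?_⟩
  have hτS : S + 1 ≤ τ := (le_max_left _ _).trans hτ
  have hτpos : 0 < τ := by linarith
  have hSτ : S ≤ τ := by linarith
  have hτB : 4 * B * S / ε ≤ τ := (le_max_right _ _).trans hτ
  -- the two pieces
  have hint : ∀ a b, IntervalIntegrable (fun s => (τ - s) * g s) volume a b := fun a b =>
    (AntiMazurCoboundariesExponentialCertificate.intervalIntegrable_of_bounded hgm hB a b).continuousOn_mul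
      (continuous_const.sub continuous_id).continuousOn
  have hsplit : ∫ s in (0 : ℝ)..τ, (τ - s) * g s =
      (∫ s in (0 : ℝ)..S, (τ - s) * g s) + ∫ s in S..τ, (τ - s) * g s :=
    (intervalIntegral.integral_add_adjacent_intervals (hint 0 S) (hint S τ)).symm
  have h1 : |∫ s in (0 : ℝ)..S, (τ - s) * g s| ≤ τ * B * (S - 0) := by
    have h := intervalIntegral.norm_integral_le_of_norm_le_const (a := 0) (b := S) (f := fun s => (τ - s) * g s)
      (C := τ * B) (fun s hs => ?_)
    · rwa [Real.norm_eq_abs, abs_of_nonneg (sub_nonneg.2 hS0)] at h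
    · rw [Set.uIoc_of_le hS0] at hs
      rw [Real.norm_eq_abs, abs_mul, abs_of_nonneg (by linarith [hs.2] : 0 ≤ τ - s)]
      exact mul_le_mul (by linarith [hs.1]) (hB s) (abs_nonneg _) hτpos.le
  have h2 : |∫ s in S..τ, (τ - s) * g s| ≤ τ * (ε / 4) * (τ - S) := by
    have h := intervalIntegral.norm_integral_le_of_norm_le_const (a := S) (b := τ) (f := fun s => (τ - s) * g s)
      (C := τ * (ε / 4)) (fun s hs => ?_)
    · rwa [Real.norm_eq_abs, abs_of_nonneg (sub_nonneg.2 hSτ)] at h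
    · rw [Set.uIoc_of_le hSτ] at hs
      rw [Real.norm_eq_abs, abs_mul, abs_of_nonneg (by linarith [hs.2] : 0 ≤ τ - s)]
      exact mul_le_mul (by linarith [hs.1]) (hgS s hs.1.le) (abs_nonneg _) hτpos.le
  rw [sub_zero] at h1
  have htot : ∫ s in (0 : ℝ)..τ, (τ - s) * g s ≤ τ * B * S + τ * (ε / 4) * τ := by
    rw [hsplit]
    have h2' : τ * (ε / 4) * (τ - S) ≤ τ * (ε / 4) * τ :=
      mul_le_mul_of_nonneg_left (by linarith) (by positivity)
    linarith [le_abs_self (∫ s in (0 : ℝ)..S, (τ - s) * g s), le_abs_self (∫ s in S..τ, (τ - s) * g s)]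
  have heq : 2 * τ⁻¹ ^ 2 * (τ * B * S + τ * (ε / 4) * τ) = 2 * (B * S) / τ + ε / 2 := by
    field_simp
    ring
  have hsmall : 2 * (B * S) / τ ≤ ε / 2 := by
    rw [div_le_iff₀ hτpos]
    have := (div_le_iff₀ hε).1 hτB
    nlinarith
  calc 2 * τ⁻¹ ^ 2 * ∫ s in (0 : ℝ)..τ, (τ - s) * g s
      ≤ 2 * τ⁻¹ ^ 2 * (τ * B * S + τ * (ε / 4) * τ) := mul_le_mul_of_nonneg_left htot (by positivity)
    _ = 2 * (B * S) / τ + ε / 2 := heq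
    _ ≤ ε := by linarith

/-! ## § 2 The rung from strong mixing -/

/-- **Registered stub `stub_stressRungOfStrongMixing` of crux stmt-AtomisticToContinuum-17740 —
`StressStrongMixing → EquilibriumStressVarianceDecay`.**  The second typed output of the Mourre package (stmt-9584:
infinite-volume kinetic shear-stress autocorrelation `c(s)` at every kinetic time, `c(s) → 0`) implies rung C3 of
route OneFlightGossipEngine (stmt-9531) — the same `L²` Green–Kubo rung that `OneBodyCompleteness` implies
(`stub_kineticStressLinearRung`): pointwise convergence of the bounded kernel `K_N(s) = (N+1)C_N(s(N+1)^{-1/3})` to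
`c(s)∫φ²`, dominated convergence on `(0,τ]`, Fejér means of `c → 0` (§ 1), then `fejerStress_of_kernel_small` and
`equilibriumStressVarianceDecay_iff_fejer_corr_decay` (activity dummy). [folklore] -/
theorem stub_stressRungOfStrongMixing : Summit.AtomisticToContinuum.HydrodynamicLimit.Theses.MourreKoopmanCharges.StressStrongMixing → Summit.AtomisticToContinuum.HydrodynamicLimit.Theses.OneFlightGossipEngine.EquilibriumStressVarianceDecay := by
  intro hSSM
  refine equilibriumStressVarianceDecay_iff_fejer_corr_decay.mpr fun a₀ θ ha hθ => ?_
  obtain ⟨σ₁, hσ₁, H⟩ := hSSM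
  refine ⟨min σ₁ (1 / 2), lt_min hσ₁ (by norm_num), fun σ hσ hσlt Φ φ hφ => ?_⟩
  simp_rw [KineticWindowGronwallNegative.localGibbsLaw_const_activity ha.ne']
  have hσ₁' : σ < σ₁ := lt_of_lt_of_le hσlt (min_le_left _ _)
  have hσhalf : σ ≤ 1 / 2 := (lt_of_lt_of_le hσlt (min_le_right _ _)).le
  obtain ⟨cf, hcf0, Hc⟩ := H σ hσ hσ₁' θ hθ
  obtain ⟨Kφ, -, hKφ⟩ := exists_forall_abs_le_of_continuous hφ
  haveI hprob : ∀ N : ℕ, IsProbabilityMeasure (localGibbsLaw σ (fun _ => (1 : ℝ)) (fun _ => (0 : V3)) (fun _ => θ) N (Φ N)) :=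
    fun N => isProbabilityMeasure_localGibbsLaw continuous_const continuous_const continuous_const
      (fun _ => one_pos) (fun _ => hθ) hσhalf N (Φ N)
  refine fejerStress_of_kernel_small Φ φ ?_
  -- notation
  set c : ℕ → ℝ := fun N => ((N : ℝ) + 1) ^ (-(1 / 3 : ℝ)) with hc
  set C : ℕ → ℝ → ℝ := fun N t => ∫ z, 𝐒[N, φ, z] * 𝐒[N, φ, (Φ N).flow t z]
    ∂(localGibbsLaw σ (fun _ => (1 : ℝ)) (fun _ => 0) (fun _ => θ) N (Φ N)) with hC
  set Kf : ℕ → ℝ → ℝ := fun N s => ((N : ℝ) + 1) * C N (s * c N) with hKf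
  set Iφ : ℝ := ∫ x, φ x * φ x with hIφ
  -- measurability and the uniform bound
  have hKm : ∀ N, Measurable (Kf N) := by
    intro N
    have hm := measurable_corr 1 θ 0 (Φ N) (measurable_stress (N := N) hφ)
    exact (hm.comp (measurable_id.mul_const (c N))).const_mul _
  set B : ℝ := θ ^ 2 * (Kφ ^ 2 * ∫ w : V3, ‖w‖ ^ 4 ∂stdGaussian V3) with hB
  have hB0 : 0 ≤ B := by
    have hM4 : 0 ≤ ∫ w : V3, ‖w‖ ^ 4 ∂stdGaussian V3 := integral_nonneg fun w => by positivity
    positivity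
  have hKB : ∀ N s, |Kf N s| ≤ B := by
    intro N s
    rw [hKf]
    dsimp only
    rw [abs_mul, abs_of_pos (by positivity : (0 : ℝ) < (N : ℝ) + 1)]
    exact succ_mul_abs_corr_le hθ (Φ N) hφ hKφ _
  -- pointwise convergence for `s ≥ 0` (the hypothesis at `χ₁ = χ₂ = φ`)
  have hSemp : ∀ (N : ℕ) (w : Config (N + 1) (Fin 3) T3),
      ∫ y, φ y.1 * (y.2 0 * y.2 1) ∂(empiricalMeasure w) = 𝐒[N, φ, w] :=
    fun N w => integral_shearGerm_empiricalMeasure φ w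
  have hpt : ∀ s : ℝ, 0 ≤ s → Tendsto (fun N => Kf N s) atTop (𝓝 (cf s * Iφ)) := by
    intro s hs
    have h := Hc Φ φ φ hφ hφ s hs
    have key : (fun N : ℕ => ((N : ℝ) + 1) * ∫ z,
        (∫ y, φ y.1 * (y.2 0 * y.2 1) ∂(empiricalMeasure ((Φ N).flow (s * ((N : ℝ) + 1) ^ (-(1 / 3 : ℝ))) z))) *
          (∫ y, φ y.1 * (y.2 0 * y.2 1) ∂(empiricalMeasure z))
        ∂(localGibbsLaw σ (fun _ => (1 : ℝ)) (fun _ => 0) (fun _ => θ) N (Φ N))) = fun N => Kf N s := by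
      funext N
      rw [hKf, hC]
      dsimp only
      congr 1
      refine integral_congr_ae (Eventually.of_forall fun z => ?_)
      dsimp only
      rw [hSemp, hSemp, mul_comm]
    rw [key] at h
    exact h
  -- the limit kernel, extended by `0` to negative times: measurable (pointwise limit) and bounded
  set K' : ℕ → ℝ → ℝ := fun N s => if 0 ≤ s then Kf N s else 0 with hK'
  set g : ℝ → ℝ := fun s => if 0 ≤ s then cf s * Iφ else 0 with hg
  have hK'm : ∀ N, Measurable (K' N) := fun N =>
    Measurable.ite measurableSet_Ici (hKm N) measurable_const
  have hK'lim : Tendsto K' atTop (𝓝 g) := by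
    rw [tendsto_pi_nhds]
    intro s
    by_cases hs : 0 ≤ s
    · simp only [hK', hg, if_pos hs]
      exact hpt s hs
    · simp only [hK', hg, if_neg hs]
      exact tendsto_const_nhds
  have hgm : Measurable g := measurable_of_tendsto_metrizable hK'm hK'lim
  have hgB : ∀ s, |g s| ≤ B := by
    intro s
    by_cases hs : 0 ≤ s
    · have h1 : Tendsto (fun N => |Kf N s|) atTop (𝓝 |cf s * Iφ|) := (hpt s hs).abs
      have h2 : |cf s * Iφ| ≤ B := le_of_tendsto' h1 fun N => hKB N s
      simpa only [hg, if_pos hs] using h2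
    · simp only [hg, if_neg hs, abs_zero]; exact hB0
  have hg0 : Tendsto g atTop (𝓝 0) := by
    have h : Tendsto (fun s => cf s * Iφ) atTop (𝓝 (0 * Iφ)) := hcf0.mul_const Iφ
    rw [zero_mul] at h
    refine h.congr' ?_
    filter_upwards [eventually_ge_atTop (0 : ℝ)] with s hs
    simp only [hg, if_pos hs]
  -- Fejér means of the limit are small for large windows
  intro ε hε
  obtain ⟨T₀, hT₀, hT⟩ := fejer_small_of_tendsto_zero hgm hgB hg0 (ε / 2) (by positivity)
  refine ⟨T₀, hT₀, fun τ hτ => ?_⟩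
  have hτpos : 0 < τ := hT₀.trans_le hτ
  -- dominated convergence on `(0, τ]`
  have hDCT : Tendsto (fun N => ∫ s in (0 : ℝ)..τ, (τ - s) * Kf N s) atTop
      (𝓝 (∫ s in (0 : ℝ)..τ, (τ - s) * g s)) := by
    refine intervalIntegral.tendsto_integral_filter_of_dominated_convergence (fun _ => τ * B) ?_ ?_ ?_ ?_
    · exact Eventually.of_forall fun N =>
        ((continuous_const.sub continuous_id).measurable.mul (hKm N)).aestronglyMeasurable
    · refine Eventually.of_forall fun N => Eventually.of_forall fun s hs => ?_
      rw [Set.uIoc_of_le hτpos.le] at hs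
      rw [Real.norm_eq_abs, abs_mul, abs_of_nonneg (by linarith [hs.2] : 0 ≤ τ - s)]
      exact mul_le_mul (by linarith [hs.1]) (hKB N s) (abs_nonneg _) hτpos.le
    · exact intervalIntegrable_const
    · refine Eventually.of_forall fun s hs => ?_
      rw [Set.uIoc_of_le hτpos.le] at hs
      have hs0 : 0 ≤ s := hs.1.le
      have h := (hpt s hs0).const_mul (τ - s)
      simp only [hg, if_pos hs0]
      exact h
  have hlim : Tendsto (fun N => 2 * τ⁻¹ ^ 2 * ∫ s in (0 : ℝ)..τ, (τ - s) * Kf N s) atTop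
      (𝓝 (2 * τ⁻¹ ^ 2 * ∫ s in (0 : ℝ)..τ, (τ - s) * g s)) := hDCT.const_mul _
  have hGτ : 2 * τ⁻¹ ^ 2 * ∫ s in (0 : ℝ)..τ, (τ - s) * g s ≤ ε / 2 := hT τ hτ
  have hev : ∀ᶠ N in atTop, 2 * τ⁻¹ ^ 2 * ∫ s in (0 : ℝ)..τ, (τ - s) * Kf N s < ε / 2 + ε / 2 :=
    hlim.eventually (gt_mem_nhds (by linarith))
  obtain ⟨N₀, hN₀⟩ := eventually_atTop.1 hev
  exact ⟨N₀, fun N hN => by linarith [hN₀ N hN]⟩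

end Summit.AtomisticToContinuum.HydrodynamicLimit.Theorems.LTEInBand

end
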